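import Summits.BirchSwinnertonDyer.BirchSwinnertonDyer.Theorems.DefiniteThetaDerivedHeightCapTowerSqrtTowerKernels
import Summits.BirchSwinnertonDyer.BirchSwinnertonDyer.Theorems.DefiniteThetaDerivedHeightCapTowerSqrtPGroupCyclic
import Mathlib.Tactic.Module
import HarnessLib

/-!
# The anticyclotomic layer groups `G_m^{ac} = Pic(𝒪_{p^m})/Δ` are CYCLIC `p`-groups of unbounded order

Route-independent `Theorems` file (cell `b2b-bsdres`, seat `b2b-bsdres-x10b`, gen 44), part 6 of the series «tower square root»
serving crux `DerivedHeightCap` (stmt-BirchSwinnertonDyer-18438, route DefiniteTheta), registered stub `stub_towerSqrt`.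
HONEST FRAMING: no curve asserted, no class closed, BSD not proved by any of this.

`K` imaginary quadratic, `p` odd; `G̃_m = Pic(𝒪_{p^m})`, `Δ_m = torsionImage K p m`, `Q_m = AcLayerGroup K p m = G̃_m/Δ_m`
(Bertolini–Darmon 2005 §1.2: the layers of `G_∞ = G̃_∞/Δ ≅ ℤ_p`). A finite-level proof that every `Q_{k+1}` is cyclic:

* §1 For `x ∈ G̃_{k+1}` call a level `M ≥ k+1` GOOD if `x` has a lift `y ∈ G̃_M` with `y^p ∈ Δ_M` (no definition is introduced;
  the phrase is spelled out). Good levels are downward closed (`good_of_le`); if all levels are good then `x ∈ Δ_{k+1}` (part 5 §3).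
* §2 `exists_good_mul_pow_inv` (DICHOTOMY): if `M ≥ k+2` is NOT good for `x₁` (with `x₁^p ∈ Δ_{k+1}`), then for every `x₂` with
  `x₂^p ∈ Δ_{k+1}` some `x₂ x₁^{-i}`, `0 ≤ i < p`, is good at `M` — the kernel `N_{M,k+1} = ⟨h⟩` is cyclic (part 5 §1) and the
  exponent of `x₁`'s defect `x_{1,M}^p t'^{-1} = h^{a₁}` is prime to `p`.
* §3 `exists_ptorsion_generator`: the `p`-torsion of `Q_{k+1}` is `{[x₁]^i : i < p}` (a finite maximum of bad levels + §2), hence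
  `exists_generator_mod_torsionImage`: **`Q_{k+1}` is cyclic**, stated as `G̃_{k+1} = ⟨c⟩ · Δ_{k+1}` (part 4 §1 with part 5 §4).
* §4 `exists_pow_prime_pow_not_mem`: an element of `G̃_{k+2}` of order `p^{k+1}` modulo `Δ` (a generator of `N_{k+2,1}`, which meets `Δ`
  trivially): the layer orders are unbounded and `Q_2 ≠ 1`.
(Statements avoid the quotient type: in this import closure its typeclass search is slow — see the local instance in §3's proof.)

## References
* [BertoliniDarmon2005] §1.2 (18)–(21); [DarmonIovita2008] §2.2 (`G̃_∞ = Δ × G_∞`, `G_n = G̃_{n+1}/Δ`); [Washington1997] §13.2.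
-/

noncomputable section

open scoped BigOperators

-- D-0017: single-problem summit, the namespace repeats the problem name by design.
set_option linter.dupNamespace false

namespace Summit.BirchSwinnertonDyer.BirchSwinnertonDyer.Theorems.TowerSqrt

open Literature.NumberTheory.EllipticCurves Literature.NumberTheory.EllipticCurves.QuadOrderTower NumberField
open Summit.BirchSwinnertonDyer.BirchSwinnertonDyer.Theorems.DefmuSupersingularTheta
  (picRes_mem_torsionImage picRes_surjective_tower)


universe u

variable {K : Type u} [Field K] [NumberField K] (p : ℕ) [hp : Fact p.Prime]

/-! ### §1 Good levels are downward closed -/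

/-- **Good levels are downward closed**: a lift at level `M` with `p`-th power in `Δ_M` restricts to such a lift at every level
`M'` between `k+1` and `M`. [cite: BertoliniDarmon2005, §1.2 (21)] -/
theorem good_of_le (k M M' : ℕ) (hM' : k + 1 ≤ M') (hMM' : M' ≤ M) (x : ClassGroup (quadOrder K (p ^ (k + 1))))
    (hgood : ∃ y : ClassGroup (quadOrder K (p ^ M)), picRes K (pow_dvd_pow p (hM'.trans hMM')) y = x ∧
      y ^ p ∈ torsionImage K p M) :
    ∃ y' : ClassGroup (quadOrder K (p ^ M')), picRes K (pow_dvd_pow p hM') y' = x ∧ y' ^ p ∈ torsionImage K p M' := by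
  obtain ⟨y, hyx, hyp⟩ := hgood
  refine ⟨picRes K (pow_dvd_pow p hMM') y, by rw [picRes_picRes]; exact hyx, ?_⟩
  rw [← map_pow]
  exact picRes_mem_torsionImage p hMM' hyp

/-! ### §2 The dichotomy at a bad level -/

/-- A commutative-group identity: `(x₂ x₁^{-i} ν^{-1})^p = x₂^p (x₁^p)^{-i} (ν^p)^{-1}`. [folklore] -/
theorem mul_inv_inv_zpow_eq {G : Type*} [CommGroup G] (x₁ x₂ ν : G) (i P : ℤ) :
    (x₂ * (x₁ ^ i)⁻¹ * ν⁻¹) ^ P = x₂ ^ P * ((x₁ ^ P) ^ i)⁻¹ * (ν ^ P)⁻¹ := by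
  apply (Additive.ofMul (α := G)).injective
  simp only [ofMul_mul, ofMul_inv, ofMul_zpow]
  module

/-- A commutative-group identity: with `x₁^p = h^{a₁} t₁`, `x₂^p = h^{a₂} t₂`, `ν^p = h^{a₂ − i a₁}` one has
`x₂^p (x₁^p)^{-i} (ν^p)^{-1} = t₂ t₁^{-i}`. [folklore] -/
theorem defect_cancel {G : Type*} [CommGroup G] (h t₁ t₂ X₁ X₂ N : G) (a₁ a₂ i : ℤ)
    (hX₁ : X₁ = h ^ a₁ * t₁) (hX₂ : X₂ = h ^ a₂ * t₂) (hN : N = h ^ (a₂ - i * a₁)) :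
    X₂ * (X₁ ^ i)⁻¹ * N⁻¹ = t₂ * (t₁ ^ i)⁻¹ := by
  subst hX₁ hX₂ hN
  apply (Additive.ofMul (α := G)).injective
  simp only [ofMul_mul, ofMul_inv, ofMul_zpow]
  module

/-- **Dichotomy at a bad level.** `K` imaginary quadratic, `p` odd, `M = k+2+j`. Let `x₁, x₂ ∈ G̃_{k+1}` with `x₁^p, x₂^p ∈ Δ_{k+1}`,
and suppose `M` is NOT good for `x₁` (no lift `y` of `x₁` to `G̃_M` has `y^p ∈ Δ_M`). Then for some `0 ≤ i < p` the level `M` IS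
good for `x₂ x₁^{-i}`. (With `N_{M,k+1} = ⟨h⟩` (part 5 §1), lifts `x_{ℓ,M}` and `t'_ℓ ∈ Δ_M` over `x_ℓ^p`: the defects
`x_{ℓ,M}^p t'^{-1}_ℓ = h^{a_ℓ}`; badness means `p ∤ a₁`, so `a₂ ≡ i a₁ (mod p)` is solvable and `h^{a₂ − i a₁}` is a `p`-th power
in `⟨h⟩`.) [cite: BertoliniDarmon2005, §1.2 (18)–(21)] -/
theorem exists_good_mul_pow_inv (hK : IsImaginaryQuadratic K) (hp2 : p ≠ 2) (k j M : ℕ) (hM : M = k + 2 + j)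
    (x₁ x₂ : ClassGroup (quadOrder K (p ^ (k + 1))))
    (hx₁ : x₁ ^ p ∈ torsionImage K p (k + 1)) (hx₂ : x₂ ^ p ∈ torsionImage K p (k + 1))
    (hbad : ¬ ∃ y : ClassGroup (quadOrder K (p ^ M)), picRes K (pow_dvd_pow p (by omega : k + 1 ≤ M)) y = x₁ ∧
      y ^ p ∈ torsionImage K p M) :
    ∃ i : ℕ, i < p ∧ ∃ y : ClassGroup (quadOrder K (p ^ M)),
      picRes K (pow_dvd_pow p (by omega : k + 1 ≤ M)) y = x₂ * (x₁ ^ i)⁻¹ ∧ y ^ p ∈ torsionImage K p M := by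
  haveI : NeZero p := ⟨hp.out.ne_zero⟩
  -- kernel generator, lifts, torsion lifts
  obtain ⟨h, hh1, hh2⟩ := exists_kernel_generator p hK k j M hM
  obtain ⟨X₁, hX₁⟩ := picRes_surjective_tower p hK (j + 1) k M (by omega) x₁
  obtain ⟨X₂, hX₂⟩ := picRes_surjective_tower p hK (j + 1) k M (by omega) x₂
  obtain ⟨t₁, ht₁, ht₁x⟩ := exists_mem_torsionImage_picRes_eq_tower p k (j + 1) M (by omega) hx₁
  obtain ⟨t₂, ht₂, ht₂x⟩ := exists_mem_torsionImage_picRes_eq_tower p k (j + 1) M (by omega) hx₂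
  -- the defects lie in the kernel `N_{M,k+1} ⊆ ⟨h⟩`
  have hker : ∀ (X t : ClassGroup (quadOrder K (p ^ M))) (x : ClassGroup (quadOrder K (p ^ (k + 1)))),
      picRes K (pow_dvd_pow p (by omega : k + 1 ≤ M)) X = x →
      picRes K (pow_dvd_pow p (by omega : k + 1 ≤ M)) t = x ^ p →
      ∃ a : ℤ, X ^ (p : ℤ) = h ^ a * t := by
    intro X t x hX ht
    have h1 : picRes K (pow_dvd_pow p (by omega : k + 1 ≤ M)) (X ^ p * t⁻¹) = 1 := by
      rw [map_mul, map_inv, map_pow, hX, ht, mul_inv_cancel]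
    obtain ⟨a, ha⟩ := Subgroup.mem_zpowers_iff.mp (ker_le_zpowers p hK hp2 k j M hM h hh1 hh2 _ h1)
    exact ⟨a, by rw [zpow_natCast, ha, inv_mul_cancel_right]⟩
  obtain ⟨a₁, ha₁⟩ := hker X₁ t₁ x₁ hX₁ ht₁x
  obtain ⟨a₂, ha₂⟩ := hker X₂ t₂ x₂ hX₂ ht₂x
  -- powers of h restrict to 1
  have hres_zpowers : ∀ ν ∈ Subgroup.zpowers h, picRes K (pow_dvd_pow p (by omega : k + 1 ≤ M)) ν = 1 := by
    intro ν hν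
    obtain ⟨b, rfl⟩ := Subgroup.mem_zpowers_iff.mp hν
    rw [map_zpow, hh1, one_zpow]
  -- badness: p ∤ a₁
  have hpa₁ : ¬ (p : ℤ) ∣ a₁ := by
    intro hdvd
    obtain ⟨ν, hν, hνp⟩ := (zpow_prime_pow_eq_one_iff_dvd p hK hp2 k j M hM h hh1 hh2 a₁).mpr hdvd
    apply hbad
    refine ⟨X₁ * ν⁻¹, by rw [map_mul, map_inv, hX₁, hres_zpowers ν hν, inv_one, mul_one], ?_⟩
    have : (X₁ * ν⁻¹) ^ p = t₁ := by
      rw [mul_pow, inv_pow, ← zpow_natCast X₁, ha₁, hνp]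
      apply (Additive.ofMul (α := ClassGroup (quadOrder K (p ^ M)))).injective
      simp only [ofMul_mul, ofMul_inv, ofMul_zpow]
      module
    rw [this]; exact ht₁
  -- solve a₂ ≡ i a₁ (mod p) with 0 ≤ i < p
  have hprime : Prime (p : ℤ) := Nat.prime_iff_prime_int.mp hp.out
  obtain ⟨u, v, huv⟩ := (Prime.coprime_iff_not_dvd hprime).mpr hpa₁
  set i₀ : ℤ := a₂ * v with hi₀
  have hp0 : (0 : ℤ) < p := by exact_mod_cast hp.out.pos
  set i : ℕ := (i₀ % p).toNat with hi
  have hi_cast : (i : ℤ) = i₀ % p := Int.toNat_of_nonneg (Int.emod_nonneg _ hp0.ne')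
  have hi_lt : i < p := by
    have : (i : ℤ) < p := by rw [hi_cast]; exact Int.emod_lt_of_pos _ hp0
    exact_mod_cast this
  have hdvd : (p : ℤ) ∣ a₂ - i * a₁ := by
    have e1 : a₂ - i * a₁ = p * (a₂ * u + (i₀ / p) * a₁) := by
      have hmod : (i : ℤ) = i₀ - p * (i₀ / p) := by rw [hi_cast, Int.emod_def]
      rw [hmod]
      linear_combination (-a₂) * huv
    exact ⟨_, e1⟩
  obtain ⟨ν, hν, hνp⟩ := (zpow_prime_pow_eq_one_iff_dvd p hK hp2 k j M hM h hh1 hh2 (a₂ - i * a₁)).mpr hdvd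
  refine ⟨i, hi_lt, X₂ * (X₁ ^ (i : ℤ))⁻¹ * ν⁻¹, ?_, ?_⟩
  · rw [map_mul, map_mul, map_inv, map_inv, map_zpow, hX₂, hX₁, hres_zpowers ν hν, inv_one, mul_one, zpow_natCast]
  · have hP : (X₂ * (X₁ ^ (i : ℤ))⁻¹ * ν⁻¹) ^ p = t₂ * (t₁ ^ (i : ℤ))⁻¹ := by
      rw [← zpow_natCast, mul_inv_inv_zpow_eq]
      exact defect_cancel h t₁ t₂ (X₁ ^ (p : ℤ)) (X₂ ^ (p : ℤ)) (ν ^ (p : ℤ)) a₁ a₂ i ha₁ ha₂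
        (by rw [zpow_natCast]; exact hνp)
    rw [hP]
    exact Subgroup.mul_mem _ ht₂ (Subgroup.inv_mem _ (Subgroup.zpow_mem _ ht₁ _))

/-! ### §3 The `p`-torsion modulo `Δ` is generated by one element; `G̃_{k+1} = ⟨c⟩ · Δ` -/

/-- **The `p`-torsion of `G̃_{k+1}/Δ` is generated by one class**: there is `x₁` with `x₁^p ∈ Δ` such that every `x₂` with
`x₂^p ∈ Δ` satisfies `x₂ x₁^{-i} ∈ Δ` for some `0 ≤ i < p`. If some such `x₁ ∉ Δ` exists, it has a bad level (part 5 §3), bad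
levels are upward closed, and the `x₂ x₁^{-i}` (`i < p`) cannot all have a bad level (take the maximum; §2); otherwise `x₁ = 1` does.
[cite: BertoliniDarmon2005, §1.2 (18)–(21)] -/
theorem exists_ptorsion_generator (hK : IsImaginaryQuadratic K) (hp2 : p ≠ 2) (k : ℕ) :
    ∃ x₁ : ClassGroup (quadOrder K (p ^ (k + 1))), x₁ ^ p ∈ torsionImage K p (k + 1) ∧
      ∀ x₂ : ClassGroup (quadOrder K (p ^ (k + 1))), x₂ ^ p ∈ torsionImage K p (k + 1) →
        ∃ i : ℕ, i < p ∧ x₂ * (x₁ ^ i)⁻¹ ∈ torsionImage K p (k + 1) := by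
  classical
  by_cases hnt : ∃ x₁ : ClassGroup (quadOrder K (p ^ (k + 1))), x₁ ^ p ∈ torsionImage K p (k + 1) ∧
      x₁ ∉ torsionImage K p (k + 1)
  · obtain ⟨x₁, hx₁p, hx₁⟩ := hnt
    refine ⟨x₁, hx₁p, fun x₂ hx₂p => ?_⟩
    -- a bad level for x₁, and all higher levels are bad
    have hbad₁ : ∃ j₀ : ℕ, ∀ j M (hM : M = k + 2 + j), j₀ ≤ j →
        ¬ ∃ y : ClassGroup (quadOrder K (p ^ M)), picRes K (pow_dvd_pow p (by omega : k + 1 ≤ M)) y = x₁ ∧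
          y ^ p ∈ torsionImage K p M := by
      by_contra hcon
      push Not at hcon
      apply hx₁
      refine mem_torsionImage_of_forall_lift p hK hp2 k x₁ fun j M hM => ?_
      obtain ⟨j', M', hM', hjj', hgood⟩ := hcon j
      exact good_of_le p k M' M (by omega) (by omega) x₁ hgood
    obtain ⟨j₀, hj₀⟩ := hbad₁
    by_contra hcon
    push Not at hcon
    -- each x₂ x₁^{-i} (i < p) is outside Δ, hence has a bad level j_i (upward closed)
    have hbad₂ : ∀ i : Fin p, ∃ j : ℕ, ∀ j' M (hM : M = k + 2 + j'), j ≤ j' →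
        ¬ ∃ y : ClassGroup (quadOrder K (p ^ M)),
          picRes K (pow_dvd_pow p (by omega : k + 1 ≤ M)) y = x₂ * (x₁ ^ (i : ℕ))⁻¹ ∧ y ^ p ∈ torsionImage K p M := by
      intro i
      by_contra hc
      push Not at hc
      apply hcon i i.isLt
      refine mem_torsionImage_of_forall_lift p hK hp2 k _ fun j M hM => ?_
      obtain ⟨j', M', hM', hjj', hgood⟩ := hc j
      exact good_of_le p k M' M (by omega) (by omega) _ hgood
    choose jf hjf using hbad₂
    -- a common bad level contradicts the dichotomy
    set J := max j₀ (Finset.univ.sup jf) with hJ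
    have hJ₀ : j₀ ≤ J := le_max_left _ _
    have hJi : ∀ i : Fin p, jf i ≤ J := fun i => (Finset.le_sup (Finset.mem_univ i)).trans (le_max_right _ _)
    obtain ⟨i, hi, y, hy, hyp⟩ := exists_good_mul_pow_inv p hK hp2 k J (k + 2 + J) rfl x₁ x₂ hx₁p hx₂p
      (hj₀ J (k + 2 + J) rfl hJ₀)
    exact hjf ⟨i, hi⟩ J (k + 2 + J) rfl (hJi ⟨i, hi⟩) ⟨y, hy, hyp⟩
  · -- no `p`-torsion outside Δ: x₁ = 1
    push Not at hnt
    refine ⟨1, by rw [one_pow]; exact Subgroup.one_mem _, fun x₂ hx₂p => ⟨0, hp.out.pos, ?_⟩⟩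
    rw [pow_zero, inv_one, mul_one]
    exact hnt x₂ hx₂p

/-- **`G̃_{k+1} = ⟨c⟩ · Δ_{k+1}`: the layer group `Pic(𝒪_{p^{k+1}})/Δ` is CYCLIC** (`K` imaginary quadratic, `p` odd) — stated
without the quotient: some class `c` generates `Pic(𝒪_{p^{k+1}})` modulo `Δ`. Proof in the quotient `Q = G̃/Δ`: a finite commutative
`p`-group (part 5 §4) whose elements killed by `p` are the `[x₁]^i`, `i < p` (§3), is cyclic (part 4 §1); these are the finite layers
of `G_∞ = G̃_∞/Δ ≅ ℤ_p`. [cite: BertoliniDarmon2005, §1.2 (18)–(21)] [cite: DarmonIovita2008, §2.2] -/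
theorem exists_generator_mod_torsionImage (hK : IsImaginaryQuadratic K) (hp2 : p ≠ 2) (k : ℕ) :
    ∃ c : ClassGroup (quadOrder K (p ^ (k + 1))), ∀ x : ClassGroup (quadOrder K (p ^ (k + 1))),
      ∃ i : ℕ, x * (c ^ i)⁻¹ ∈ torsionImage K p (k + 1) := by
  classical
  -- local instance: keeps the typeclass search for the quotient away from `IsCyclic.isMulCommutative`
  haveI : IsMulCommutative (ClassGroup (quadOrder K (p ^ (k + 1)))) := CommMagma.to_isCommutative
  haveI : Finite (ClassGroup (quadOrder K (p ^ (k + 1)))) := finite_classGroup (K := K) _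
  letI : Fintype (ClassGroup (quadOrder K (p ^ (k + 1))) ⧸ torsionImage K p (k + 1)) := Fintype.ofFinite _
  set N := torsionImage K p (k + 1) with hN
  -- at most p classes are killed by p
  obtain ⟨x₁, -, hx₁⟩ := exists_ptorsion_generator p hK hp2 k
  have hcard : (Finset.univ.filter fun q : ClassGroup (quadOrder K (p ^ (k + 1))) ⧸ N => q ^ p = 1).card ≤ p := by
    have hsub : (Finset.univ.filter fun q : ClassGroup (quadOrder K (p ^ (k + 1))) ⧸ N => q ^ p = 1) ⊆
        (Finset.range p).image fun i => (QuotientGroup.mk' N x₁) ^ i := by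
      intro q hq
      obtain ⟨x₂, rfl⟩ := QuotientGroup.mk'_surjective N q
      rw [Finset.mem_filter, ← map_pow, QuotientGroup.mk'_apply] at hq
      obtain ⟨i, hi, hmem⟩ := hx₁ x₂ ((QuotientGroup.eq_one_iff _).mp hq.2)
      refine Finset.mem_image.mpr ⟨i, Finset.mem_range.mpr hi, ?_⟩
      rw [← map_pow, QuotientGroup.mk'_apply, QuotientGroup.mk'_apply, QuotientGroup.eq]
      have : (x₁ ^ i)⁻¹ * x₂ = x₂ * (x₁ ^ i)⁻¹ := mul_comm _ _
      rw [this]; exact hmem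
    calc _ ≤ ((Finset.range p).image fun i => (QuotientGroup.mk' N x₁) ^ i).card := Finset.card_le_card hsub
      _ ≤ (Finset.range p).card := Finset.card_image_le
      _ = p := Finset.card_range p
  have hcyc : IsCyclic (ClassGroup (quadOrder K (p ^ (k + 1))) ⧸ N) :=
    isCyclic_of_isPGroup_of_card_le (isPGroup_acLayerGroup p hK k) hcard
  obtain ⟨g, hg⟩ := hcyc.exists_generator
  obtain ⟨c, rfl⟩ := QuotientGroup.mk'_surjective N g
  refine ⟨c, fun x => ?_⟩
  obtain ⟨i, hi⟩ := ((isOfFinOrder_of_finite _).mem_powers_iff_mem_zpowers).mpr (hg (QuotientGroup.mk' N x))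
  refine ⟨i, ?_⟩
  have hi' : QuotientGroup.mk' N (c ^ i) = QuotientGroup.mk' N x := by rw [map_pow]; exact hi
  rw [QuotientGroup.mk'_apply, QuotientGroup.mk'_apply, QuotientGroup.eq] at hi'
  have : (c ^ i)⁻¹ * x = x * (c ^ i)⁻¹ := mul_comm _ _
  rw [← this]; exact hi'

/-! ### §4 An element of order `p^{k+1}` modulo `Δ` in `G̃_{k+2}` -/

/-- The order of a kernel generator: `h ∈ N_{k+2+j, k+1}` with `res_{→k+2} h ≠ 1` has order `p^{j+1}`. [cite: Cox2013, §7.D Thm. 7.24] -/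
theorem orderOf_kernel_generator (hK : IsImaginaryQuadratic K) (hp2 : p ≠ 2) (k j M : ℕ) (hM : M = k + 2 + j)
    (h : ClassGroup (quadOrder K (p ^ M))) (h1 : picRes K (pow_dvd_pow p (by omega : k + 1 ≤ M)) h = 1)
    (h2 : picRes K (pow_dvd_pow p (by omega : k + 2 ≤ M)) h ≠ 1) : orderOf h = p ^ (j + 1) := by
  refine orderOf_eq_prime_pow ?_ ?_
  · exact Summit.BirchSwinnertonDyer.BirchSwinnertonDyer.Theorems.DefmuSupersingularTheta.pow_pow_ne_one_of_picRes
      p hK hp2 j k M hM h h1 h2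
  · exact Summit.BirchSwinnertonDyer.BirchSwinnertonDyer.Theorems.DefmuSupersingularTheta.pow_pow_eq_one_of_picRes_eq_one_tower
      p hK (j + 1) k M (by omega) h h1

/-- **An element of order `p^{k+1}` modulo `Δ` in `Pic(𝒪_{p^{k+2}})`**: a generator `h` of `N_{k+2,1}` has `h^{p^{k+1}} = 1` and
`h^{p^k} ∉ Δ_{k+2}` (`⟨h⟩ ∩ Δ ⊆ N_{k+2,1} ∩ Δ = 1`, part 5 §2). So `#(G̃_{k+2}/Δ) ≥ p^{k+1}`: the layer orders are unbounded, and
`G̃_2/Δ ≠ 1`. [cite: BertoliniDarmon2005, §1.2 (18)–(21)] -/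
theorem exists_pow_prime_pow_not_mem (hK : IsImaginaryQuadratic K) (hp2 : p ≠ 2) (k : ℕ) :
    ∃ h : ClassGroup (quadOrder K (p ^ (k + 2))), h ^ p ^ (k + 1) = 1 ∧ h ^ p ^ k ∉ torsionImage K p (k + 2) := by
  obtain ⟨h, hh1, hh2⟩ := exists_kernel_generator p hK 0 k (k + 2) (by omega)
  have hord : orderOf h = p ^ (k + 1) := orderOf_kernel_generator p hK hp2 0 k (k + 2) (by omega) h hh1 hh2
  refine ⟨h, by rw [← hord]; exact pow_orderOf_eq_one h, fun hmem => ?_⟩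
  have hres : picRes K (pow_dvd_pow p (by omega : 0 + 1 ≤ k + 2)) (h ^ p ^ k) = 1 := by
    rw [map_pow, hh1, one_pow]
  have h1 := eq_one_of_mem_torsionImage_of_picRes_eq_one_tower p hK hp2 0 (k + 1) (k + 2) (by omega) hmem hres
  have hdvd : orderOf h ∣ p ^ k := orderOf_dvd_of_pow_eq_one h1
  rw [hord] at hdvd
  exact absurd (Nat.le_of_dvd (pow_pos hp.out.pos _) hdvd)
    (not_le.mpr (Nat.pow_lt_pow_right hp.out.one_lt (Nat.lt_succ_self k)))

end Summit.BirchSwinnertonDyer.BirchSwinnertonDyer.Theorems.TowerSqrt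

end
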